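import Summits.ResolutionOfSingularities.ResolutionOfSingularities.Theorems.FrobeniusClosingSteerArithTransportFineAfterA
import HarnessLib

/-!
# K-β0(b) fine word (F-AB) — CLOSED-MODULO ONE NAMED RESIDUAL: the off-axis landing exclusion `OffAxisLandingExcludedATwoN` (word) and the
  PROVED glue `binaryBConeAfterATwoN_of_offAxis : OffAxisLandingExcludedATwoN → BinaryBConeAfterATwoN` (res-L0-w41-plan-1 RULINGs 318 (d) /
  322 (ii) / 328 (c) pattern «closed-modulo a named residual at lapse»)

OURS (campaign `res-hironaka`, rung L ★L-G4, slot W4.1 · crux `Steer` (stmt-ResolutionOfSingularities-16345) · K-β0(b)). Candidates, not facts;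
nothing here is a statement of H. Hironakaʼs manuscript [claim: Hironaka2017, status: under-review]; AI-written, AI review is weaker than expert review.

`…ArithTransportFineAfterA` proves (F-AB) at every visit whose landing point lies ON THE AXIS `V(m₁/u, m₂/u)` of the departing `e = 2` cone
(`binaryBConeE2At_afterA_online`, hypotheses `v m₁ < v u`, `v m₂ < v u`). What is left of (F-AB) is therefore the OFF-AXIS EXCLUSION below: (F-AB)ʼs
binders VERBATIM, the cone data of `ArithTransport.BinaryConeE2At R s 2 d j` made explicit, conclusion `v m₁ < v u ∧ v m₂ < v u`. Why it should hold
(res-L0-w41-tri-1 TRIAGE v6.67 (B) «off-line: the lifted irreducible factor at a root direction is a regular parameter of R′/u — r ≤ d − 1 by e = 2 ⇒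
clord′ ≤ d»; res-D-pv-053ʼs NEAR-A kit): `v mᵢ ≤ v u` always (`u` has maximal value on `𝔪_j`); if `v m₁ = v u`, then `m₁/u` is a unit of `R j′` and
the landing direction `(m̄₁′ : m̄₂′) ≠ 0`; either `Ψ̄` does not vanish there — then `s_{j′}² = T² + u·(unit)` and NO cleaned order `≥ 2` exists
(`ArithTransportFine.not_hasCleanedOrderAt_of_isUnit`, p580900) — or it vanishes, and `NearA.parityBound` (p57 series ✓) with res-D-repro-2ʼs bridge
`NonRationalWindow.exists_initialForm_mem_pow` puts `Ψ̄(T₁, T₂)` into `𝔮^d` at the landing point `𝔮`; as `Ψ̄` is a FORM of degree `d` in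
`(T₁, T₂)`, Taylor expansion at the point and homogeneity (`(1 + α²)^i` has the constant term `1` for `i ≥ 1`, characteristic `2`) force
`Ψ̄ = c·ℓ^d` over `κ(𝔮)`, against `e = 2` (descended to `κ_j` by `ArithTransportFine.e2_of_map`, `d` odd). Not proved here (the bridge bookkeeping
is M-sized); typed so that **(F-AB) = CLOSED-MODULO {`OffAxisLandingExcludedATwoN`} BY NAME**.
[invented: ours] [cite: Matsumura1987, Thm. 14.2] [folklore]
-/

noncomputable section

-- `Summit.<S>.<S>.…` duplicates the summit name by design (single-problem summit).
set_option linter.dupNamespace false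

open IsLocalRing MvPolynomial
open Literature.AlgebraicGeometry.Resolution
open Summit.ResolutionOfSingularities.ResolutionOfSingularities.Theorems.SwitchingDichotomy.Words

namespace Summit.ResolutionOfSingularities.ResolutionOfSingularities.Theorems.SwitchingDichotomy.ArithTransportFine

open Summit.ResolutionOfSingularities.ResolutionOfSingularities.Theorems.SwitchingDichotomy (SigmaTopLegality.IsSingPrime)

/-- **(OFF-A) · `OffAxisLandingExcludedATwoN`** — the OFF-AXIS LANDING EXCLUSION at an A → B visit (the residual of (F-AB), OPEN): (F-AB)ʼs binders
verbatim (steered run at `p = 2`, characteristic `2`, `R 0` dominated, regular members of dimension `4`; visit pair `(j, j′)`, exceptional parameter `u`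
with its strip clause, N4ʼs height-one clause at `j′`, `d` odd `≥ 3`, A-stage `j`), then the cone data of `BinaryConeE2At R s 2 d j` EXPLICIT
(`s_j² − g² − Ψ(m₁, m₂) ∈ 𝔪^(d+1)`, `(m₁, m₂)` an r.s.o.p.-part, `Ψ` a form of degree `d`, `Ψ̄` not `c·ℓ^d`), landing with cleaned order `d + 1`
⇒ the pair lies ON THE AXIS of `u`: `v m₁ < v u ∧ v m₂ < v u` (i.e. no `mᵢ/u` is a unit of `R j′`). Consumer: `binaryBConeAfterATwoN_of_offAxis`.
Why it might fail: it should not (module docstring: unit sub-case p580900, root sub-case = NEAR-A reading + homogeneity); a failure would be a landing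
point off the axis with cleaned order `d + 1`, i.e. a root of `Ψ̄` of multiplicity `≥ d`, excluded by `e = 2`. OURS. [invented: ours] (folklore) -/
def OffAxisLandingExcludedATwoN : Prop :=
  ∀ (K : Type) [Field K] [CharP K 2] (O : ValuationSubring K)
    (R : ℕ → Subring K) (P : (i : ℕ) → Ideal (R i)) (t : K) (s : ℕ → K),
    IsSteeredRun O R P t 2 s → SubringDominates (R 0) O.toSubring →
    (∀ i, IsRegularLocalRing (R i)) → (∀ i, ringKrullDim (R i) = (4 : ℕ)) →
    ∀ (j j' : ℕ) (u : K) (d : ℕ), Odd d → 3 ≤ d → IsVisitPair R P j j' → IsExcParamAlong O (R j) (P j) u →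
      (∀ l, j < l → l < j' → ∃ hu : u ∈ R l, P l = Ideal.span {(⟨u, hu⟩ : R l)}) →
      (∀ (hs' : s j' ^ 2 ∈ R j') (Q : Ideal (R j')) [Q.IsPrime], Q.height = 1 →
        ¬ SigmaTopLegality.IsSingPrime (R j') 2 ⟨s j' ^ 2, hs'⟩ Q) →
      IsAStageAt R P s 2 j d →
      ∀ (_ : IsLocalRing (R j)) (hs : s j ^ 2 ∈ R j) (g m₁ m₂ : R j) (Ψ : MvPolynomial (Fin 2) (R j)),
        IsRsopPart ![m₁, m₂] → Ψ.IsHomogeneous d →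
        (⟨s j ^ 2, hs⟩ : R j) - g ^ 2 - MvPolynomial.eval ![m₁, m₂] Ψ ∈ maximalIdeal (R j) ^ (d + 1) →
        (¬ ∃ a b c : ResidueField (R j),
          MvPolynomial.map (residue (R j)) Ψ = MvPolynomial.C c * (MvPolynomial.C a * MvPolynomial.X 0 + MvPolynomial.C b * MvPolynomial.X 1) ^ d) →
        HasCleanedOrderAt R s 2 j' (d + 1) →
        O.valuation (m₁ : K) < O.valuation u ∧ O.valuation (m₂ : K) < O.valuation u

/-- **(F-AB) from the off-axis exclusion** (glue, PROVED): destructure the cone of `BinaryConeE2At R s 2 d j`, obtain `v m₁, v m₂ < v u` from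
`OffAxisLandingExcludedATwoN`, and apply `binaryBConeE2At_afterA_online`. Hence (F-AB) `BinaryBConeAfterATwoN` = CLOSED-MODULO
{`OffAxisLandingExcludedATwoN`} by name. [folklore] -/
theorem binaryBConeAfterATwoN_of_offAxis (h : OffAxisLandingExcludedATwoN) : BinaryBConeAfterATwoN := by
  intro K _ _ O R P t s hrun hR0 hreg hdim j j' u d hd h3 hvisit hu Hγ h1 hA hcone hclj'
  obtain ⟨hloc, hs, g, m₁, m₂, Ψ, hm, hΨ, hcong, hE⟩ := hcone
  obtain ⟨hon₁, hon₂⟩ := h K O R P t s hrun hR0 hreg hdim j j' u d hd h3 hvisit hu Hγ h1 hA hloc hs g m₁ m₂ Ψ hm hΨ hcong hE hclj'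
  exact binaryBConeE2At_afterA_online hrun hR0 hreg hvisit hu Hγ h1 hd h3 hs hm hΨ hcong hE hon₁ hon₂ hclj'

end Summit.ResolutionOfSingularities.ResolutionOfSingularities.Theorems.SwitchingDichotomy.ArithTransportFine
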